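import Summits.Ventures.CertifiedManyBodySolver.Downfold.EmeryFermiScaleFaceCertB
import HarnessLib

/-!
# THE ANTINODAL SCALE LEVER AT `t_pp′ = 0`: on the face window and under `t_ppΔ < 4t_pd²`, the velocity-matched one-band `t` at the zone-face point of the σ Fermi surface,
# `t_face(ε) = scaleT(1, yFace; ε)`, is strictly DECREASING in the Fermi energy — with the nodal lever, BOTH ENDS of the certified `t_eff` window rise under hole doping

Venture CertifiedManyBodySolver, cell `pub/hubbard-downfold` (stage S1; INFLATION-RULES-3to1-B §B.74 (b′)), seat hubbard-downfold-mod-4 (technique B, g29); namespace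
`Summit.Ventures.CertifiedManyBodySolver.Downfold.Emery`. Sequel of `EmeryFermiScaleFace` (`scaleT_face_eq`) and `EmeryFermiScaleFaceCertA/B` (`scaleFaceCert`, `scaleFaceCert_pos`).
Everything PROVED (0 sorry). WHAT THIS IS NOT: a statement about any material; `U = 0` one-body kinematics; the `t_pp′ > 0` case is NOT covered (no low-degree certificate — kit
j339274/291/302/327; census-grade only): of the typed rows, the HSTMI22 quintet (printed without `t_pp′`) is inside this theorem, the (K) and conventional-Emery rows are not.

* §1 `scaleFace_cross_eq`: `L·(scaleFaceN(ε₁)scaleFaceD(ε₂) − scaleFaceN(ε₂)scaleFaceD(ε₁)) = (ε₂ − ε₁)·scaleFaceCert(…)` at `t_pp′ = 0`, `L = 1189234894484992` (`ring`).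
* §2 **`scaleT_face_strictAnti_pure`**: `Δ > 0`, `0 ≤ t_pp`, `t_pd ≠ 0`, `0 < ε₁ < ε₂`, `faceG(ε₁) ≥ 0` (the `ε₁`-surface hole-like), the `ε₂`-surface in the zone, `t_ppΔ < 4t_pd²` ⇒
  `t_face(ε₂) < t_face(ε₁)`; bracket rule `scaleFaceLeverCheck` (rational inputs, `t_pp′ = 0`) with `scaleT_face_strictAnti_of_check` and `scaleFaceLever_of_brackets`.

Sources: three-band model [HybertsenSchluterChristensen1989, Eq. (1)]; [AndersenEtAl1995, §6]; Handelman certificates [folklore].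
-/

noncomputable section

namespace Summit.Ventures.CertifiedManyBodySolver.Downfold.Emery

open Real Set

/-! ## §1 The certificate identity (t_pp′ = 0) -/

set_option maxRecDepth 8192 in
/-- **THE CERTIFICATE IDENTITY** (`t_pp′ = 0`, `t_pp = h`, `ε₂ = ε₁ + d`; scaled by `L = 1189234894484992`). [folklore] -/
theorem scaleFace_cross_eq (Δ tpd h ε₁ d : ℝ) :
    (1189234894484992 : ℝ) * (scaleFaceN Δ tpd h 0 ε₁ * scaleFaceD Δ tpd h 0 (ε₁ + d) - scaleFaceN Δ tpd h 0 (ε₁ + d) * scaleFaceD Δ tpd h 0 ε₁) =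
      d * scaleFaceCert Δ ε₁ d (tpd ^ 2) h (4 * tpd ^ 2 - h * Δ) (ε₁ * (Δ + ε₁) - 4 * tpd ^ 2)
        (8 * (Δ + (ε₁ + d)) * tpd ^ 2 + 16 * h * (2 * tpd ^ 2 + h * (ε₁ + d)) - (ε₁ + d) * (Δ + (ε₁ + d)) ^ 2) := by
  unfold scaleFaceN scaleFaceD fsT fsD faceN faceR fsN scaleFaceCert scaleFaceCertP1 scaleFaceCertP2 scaleFaceCertP3 scaleFaceCertP4 scaleFaceCertP5 scaleFaceCertP6
    scaleFaceCertP7 scaleFaceCertP8 scaleFaceCertP9 scaleFaceCertP10 scaleFaceCertP11 scaleFaceCertP12 scaleFaceCertP13 scaleFaceCertP14 scaleFaceCertP15 scaleFaceCertP16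
    scaleFaceCertP17
  ring

/-! ## §2 The antinodal scale lever at t_pp′ = 0 -/

/-- **THE ANTINODAL SCALE IS STRICTLY DECREASING IN THE FERMI ENERGY** (`t_pp′ = 0`; `Δ > 0`, `t_pp ≥ 0`, `t_pd ≠ 0`, `0 < ε₁ < ε₂`, `faceG(ε₁) ≥ 0`,
`cA(ε₂) ≤ 8fsD(ε₂) + 16fsN(ε₂)`, `t_ppΔ < 4t_pd²`): `scaleT(1, yFace(ε₂); ε₂) < scaleT(1, yFace(ε₁); ε₁)` — hole doping RAISES the one-band `t` at the antinode. [folklore] -/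
theorem scaleT_face_strictAnti_pure {Δ tpd tpp ε₁ ε₂ : ℝ} (hΔ : 0 < Δ) (htpp : 0 ≤ tpp) (htpd : tpd ≠ 0) (h1 : 0 < ε₁) (h12 : ε₁ < ε₂)
    (hlo : 0 ≤ faceG Δ tpd 0 ε₁) (hhi : cA Δ ε₂ ≤ 8 * fsD Δ tpd 0 ε₂ + 16 * fsN tpd tpp 0 ε₂) (hq : tpp * Δ < 4 * tpd ^ 2) :
    scaleT Δ tpd tpp 0 1 (yFace Δ tpd tpp 0 ε₂) ε₂ < scaleT Δ tpd tpp 0 1 (yFace Δ tpd tpp 0 ε₁) ε₁ := by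
  have h2 : 0 < ε₂ := h1.trans h12
  have ht : 0 < tpd ^ 2 := by positivity
  have hm1 : (0 : ℝ) * ε₁ < tpd ^ 2 := by simpa using ht
  have hm2 : (0 : ℝ) * ε₂ < tpd ^ 2 := by simpa using ht
  have hlo2 : 0 ≤ faceG Δ tpd 0 ε₂ := hlo.trans (faceG_mono hΔ.le le_rfl h1.le h12.le)
  rw [scaleT_face_eq (by linarith) le_rfl htpp h2 hm2 hlo2, scaleT_face_eq (by linarith) le_rfl htpp h1 hm1 hlo,
    div_lt_div_iff₀ (scaleFaceD_pos (by linarith) le_rfl htpp h2 hm2 hlo2) (scaleFaceD_pos (by linarith) le_rfl htpp h1 hm1 hlo), ← sub_pos]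
  obtain ⟨d, rfl⟩ : ∃ d, ε₂ = ε₁ + d := ⟨ε₂ - ε₁, by ring⟩
  have hd : 0 < d := by linarith
  have hG₂ : 0 ≤ 8 * (Δ + (ε₁ + d)) * tpd ^ 2 + 16 * tpp * (2 * tpd ^ 2 + tpp * (ε₁ + d)) - (ε₁ + d) * (Δ + (ε₁ + d)) ^ 2 := by
    have e := faceHi_eq Δ tpd tpp 0 (ε₁ + d)
    have e2 : 8 * (Δ + (ε₁ + d)) * (tpd ^ 2 - 0 * (ε₁ + d)) + 16 * (0 + (tpp - 0) + 0) * (2 * tpd ^ 2 + (tpp - 0) * (ε₁ + d)) - (ε₁ + d) * (Δ + (ε₁ + d)) ^ 2 =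
        8 * (Δ + (ε₁ + d)) * tpd ^ 2 + 16 * tpp * (2 * tpd ^ 2 + tpp * (ε₁ + d)) - (ε₁ + d) * (Δ + (ε₁ + d)) ^ 2 := by ring
    linarith
  have hG₁ : 0 ≤ ε₁ * (Δ + ε₁) - 4 * tpd ^ 2 := by unfold faceG at hlo; linarith
  have hQ : 0 ≤ 4 * tpd ^ 2 - tpp * Δ := by linarith
  have key := scaleFace_cross_eq Δ tpd tpp ε₁ d
  have hC := scaleFaceCert_pos (a := tpd ^ 2) hΔ.le h1 hd ht.le htpp hQ hG₁ hG₂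
  have hL : (0 : ℝ) < 1189234894484992 := by norm_num
  -- L·X = d·C > 0 ⇒ X > 0
  have hX : 0 < scaleFaceN Δ tpd tpp 0 ε₁ * scaleFaceD Δ tpd tpp 0 (ε₁ + d) - scaleFaceN Δ tpd tpp 0 (ε₁ + d) * scaleFaceD Δ tpd tpp 0 ε₁ := by
    have : 0 < (1189234894484992 : ℝ) * (scaleFaceN Δ tpd tpp 0 ε₁ * scaleFaceD Δ tpd tpp 0 (ε₁ + d) - scaleFaceN Δ tpd tpp 0 (ε₁ + d) * scaleFaceD Δ tpd tpp 0 ε₁) := by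
      rw [key]; exact mul_pos hd hC
    exact pos_of_mul_pos_right this hL.le
  linarith

/-- **`scaleFaceLeverCheck`** (`t_pp′ = 0`): a σ point `(Δ, a, b) = (Δ_pd, t_pd, t_pp) ∈ ℚ³`, the bottom `e₁` of the LOWER ε_F bracket and the top `e₂` of the HIGHER one; tests: regime,
lower face-window edge at `e₁`, upper edge at `e₂`, `t_ppΔ < 4t_pd²`. [folklore] -/
def scaleFaceLeverCheck (Δ a b e₁ e₂ : ℚ) : Bool :=
  decide (0 < Δ) && decide (0 ≤ b) && decide (a ≠ 0) && decide (0 < e₁) && decide (0 ≤ e₁ * (Δ + e₁) - 4 * a ^ 2) &&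
  decide (e₂ * (Δ + e₂) ^ 2 ≤ 8 * ((Δ + e₂) * (a ^ 2 - 0 * e₂)) + 16 * (2 * a ^ 2 * (0 + b) + e₂ * (b ^ 2 - 0 ^ 2))) && decide (b * Δ < 4 * a ^ 2)

/-- **SOUNDNESS of `scaleFaceLeverCheck`**: for all real `e₁ ≤ ε₁ < ε₂ ≤ e₂`, `t_face(ε₂) < t_face(ε₁)` at the σ point `(Δ, a, b, 0)`. [folklore] -/
theorem scaleT_face_strictAnti_of_check {Δ a b e₁ e₂ : ℚ} (h : scaleFaceLeverCheck Δ a b e₁ e₂ = true) {ε₁ ε₂ : ℝ} (h1 : (e₁ : ℝ) ≤ ε₁) (h12 : ε₁ < ε₂) (h2 : ε₂ ≤ (e₂ : ℝ)) :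
    scaleT (Δ : ℝ) a b 0 1 (yFace (Δ : ℝ) a b 0 ε₂) ε₂ < scaleT (Δ : ℝ) a b 0 1 (yFace (Δ : ℝ) a b 0 ε₁) ε₁ := by
  simp only [scaleFaceLeverCheck, Bool.and_eq_true, decide_eq_true_eq] at h
  obtain ⟨⟨⟨⟨⟨⟨hΔ, hb⟩, ha⟩, he⟩, hlo⟩, hhi⟩, hq⟩ := h
  have hΔ' : (0 : ℝ) < Δ := by exact_mod_cast hΔ
  have hε₁ : 0 < ε₁ := lt_of_lt_of_le (by exact_mod_cast he) h1
  have hlo' : 0 ≤ faceG (Δ : ℝ) a 0 ε₁ := by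
    have h0 : 0 ≤ faceG (Δ : ℝ) a 0 e₁ := by unfold faceG; nlinarith [show (0:ℝ) ≤ (e₁ : ℝ) * ((Δ : ℝ) + e₁) - 4 * (a : ℝ) ^ 2 by exact_mod_cast hlo]
    exact h0.trans (faceG_mono hΔ'.le le_rfl (by exact_mod_cast he.le) h1)
  have hhi' : cA (Δ : ℝ) ε₂ ≤ 8 * fsD (Δ : ℝ) a 0 ε₂ + 16 * fsN (a : ℝ) b 0 ε₂ := by
    have h0 : cA (Δ : ℝ) e₂ ≤ 8 * fsD (Δ : ℝ) a 0 e₂ + 16 * fsN (a : ℝ) b 0 e₂ := by unfold cA fsD fsN; exact_mod_cast hhi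
    exact faceHi_anti hΔ'.le le_rfl (by linarith [show (0:ℝ) ≤ b by exact_mod_cast hb]) (hε₁.trans h12) h2 h0
  exact scaleT_face_strictAnti_pure hΔ' (by exact_mod_cast hb) (by exact_mod_cast ha) hε₁ h12 hlo' hhi' (by exact_mod_cast hq)

/-- **THE ANTINODAL SCALE LEVER FROM BRACKETS** (`t_pp′ = 0`): `scaleFaceLeverCheck Δ a b e₁ f₂`, `e₂ < f₁`, `ε₁ ∈ [e₁, e₂]`, `ε₂ ∈ [f₁, f₂]` ⇒ `ε₁ < ε₂ ∧ t_face(ε₂) < t_face(ε₁)`. [folklore] -/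
theorem scaleFaceLever_of_brackets {Δ a b e₁ e₂ f₁ f₂ : ℚ} (h : scaleFaceLeverCheck Δ a b e₁ f₂ = true) (hgap : e₂ < f₁) {ε₁ ε₂ : ℝ}
    (h1 : ε₁ ∈ Set.Icc (e₁ : ℝ) e₂) (h2 : ε₂ ∈ Set.Icc (f₁ : ℝ) f₂) :
    ε₁ < ε₂ ∧ scaleT (Δ : ℝ) a b 0 1 (yFace (Δ : ℝ) a b 0 ε₂) ε₂ < scaleT (Δ : ℝ) a b 0 1 (yFace (Δ : ℝ) a b 0 ε₁) ε₁ := by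
  have hgap' : (e₂ : ℝ) < f₁ := by exact_mod_cast hgap
  have h12 : ε₁ < ε₂ := lt_of_le_of_lt h1.2 (lt_of_lt_of_le hgap' h2.1)
  exact ⟨h12, scaleT_face_strictAnti_of_check h h1.1 h12 h2.2⟩

end Summit.Ventures.CertifiedManyBodySolver.Downfold.Emery
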